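import Mathlib
import Summits.Ventures.FusionMHD.Models.CerfonFreidbergIterLikeQHalfLevel
import Summits.Ventures.FusionMHD.Models.FluxSurfacePolarRayLevelGGJMercier
import HarnessLib

/-!
# Ventures/FusionMHD — Models/CerfonFreidbergIterLikeQHalfGGJ.lean: the thirteen Jardin (8.134) inputs of the surface `ψ_N = 1/2`
# of THE Cerfon–Freidberg ITER-like flux as ONE `SurfaceData`, every input ONE θ-integral of a CLOSED-FORM kernel along the
# certified radius, and the Mercier criterion there as ONE polynomial inequality in SIX such integrals

HONEST FRAMING (LADDER-GRIDFUSION three columns; CF rung, F2 item R2; «F2.R2-POLAR-GGJ-DATA» instance, LOW, no count; lead g8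
RULING 9bk (2)).  The GENERIC bookkeeping is model-7's `Models/FluxSurfacePolarRayLevelGGJ{,Mercier}.lean`
(`PolarRay.ggjData`, `PolarRay.mercierRegisterForm`, `LevelLoop.mercierCriterion_ggjData_iff`); the LOOP is ★ #117's certificate re-read
with level margins (`…QHalfLevel.levelLoop`, level margin `10⁻¹⁰`); the typed criterion is gridfusion-lit-3's
`Literature/…/MercierFluxForm.lean` (Jardin 2010 (8.134) VERBATIM).
* CERTIFIED (kernel; this file + imports, axioms standard): for THE flux `U = cfSolution 0 coeff` of the CF ITER-like instance
  (`Δ*U = X²`: constant free function `F`, `μ₀p′ = −1`, `σB² = J·B ≡ F` — the `C = 1` member of the Solov'ev class) and EVERY level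
  `u` with `|u − u₀| < 10⁻¹⁰` (`u₀ = U(X_a,0)/2`, i.e. `ψ_N = 1/2`): (§1) the gradient-squared field along rays IS the written-out
  closed form `Gfield = U_X² + U_Y²` (`UXc`, `UYc` of `…QHalfSound`; `dR_U_eq` / `dZ_U_eq` against the Literature closed forms by
  `ring`) and `Δ*U = X²` on every box; (§2) `ggjData F u := PolarRay.ggjData F 1 U X_a 0 u` has, BY NAME from the generic files,
  `V′ = 2π∫₀^{2π} volKernel`, `V″ = 2π∫₀^{2π} volKernelDs/D`, `Φ′ = F∫₀^{2π} polarKernel` (`= 2πq`, and at `u₀`: `= 2πF·qHalfOverF`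
  with ★ #117's bracket), `Φ″ = F∫₀^{2π} polarKernelDs/D`, `Ψ′ = 2π`, `Ψ″ = 0`, `K′ = 0`, `p′ = −1`, and the four averages
  `⟨σB²/G⟩ = F∫invGradKernel/∫volKernel`, `⟨σ²B²/G⟩ = F²∫sigmaSqKernel/∫volKernel`, `⟨B²/G⟩ = ∫bsqGradKernel/∫volKernel`,
  `⟨1/B²⟩ = ∫invBsqKernel/∫volKernel`, all with the fields `Dfield = D_r`, `F2field = ∂_s D_r`, `Gfield = |∇U|²` along `ρ_u`;
  (§3) **`mercierCriterion_iff`**: Jardin's criterion (8.134) on the surface `U = u` ⟺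
  `0 < PolarRay.mercierRegisterForm F 1 Pd Wd Aσ As AB Ai` with SIX θ-integrals over `[0, 2π]` of closed-form kernels along `ρ_u`
  (`mercierCriterion_half_iff` at `u₀` with ★ #117's `ρ`).
* VALIDATED: nothing used.  NO numerical value of any register and NO sign of `F` is claimed: the six registers are six more top
  registers of gridfusion-model-5's Taylor-model program (+ tube constants via `LevelPanel.kernel_integral_tube`), MODEL-7-NOTES §4/§6.
* MODELLED: analytic Cerfon–Freidberg family (Freidberg 2014 §6.6.1, `α = 0`), ideal MHD; the Mercier criterion is NECESSARY for ideal
  interchange stability of the MODEL, not sufficient — never «stable», never a device.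
Typer/prover: gridfusion-model-7 (g6), 2026-08-27.  Citations: Jardin 2010 (5.29)–(5.35), (8.134) [Jardin2010]; Freidberg 2014 (6.35),
(6.153) [Freidberg2014].
-/

noncomputable section

open Set MeasureTheory intervalIntegral Filter Topology
open Literature.MathematicalPhysics.MHD Literature.MathematicalPhysics.MHD.CerfonFreidberg Literature.MathematicalPhysics.MHD.GradShafranov
  Literature.MathematicalPhysics.MHD.FluxGeometry Literature.MathematicalPhysics.MHD.Mercier.FluxForm
open Summit.Ventures.FusionMHD.Models.PolarRay

namespace Summit.Ventures.FusionMHD.Models.CFIterLike.QHalf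

/-! ## §1 The gradient-squared field along rays in closed form, and `Δ*U = X²` on the boxes -/

/-- `U_X` of THE flux is the written-out closed form `UXc coeff` (`X ≠ 0`). [cite: Freidberg2014, §6.6.1 eq. (6.153)] -/
theorem dR_U_eq {X : ℝ} (hX : X ≠ 0) (Y : ℝ) : dR U X Y = UXc coeff X Y := by
  unfold U
  rw [dR_cfSolution_zero coeff hX Y]
  simp only [radP₂, radP₄, radP₆, radQ₂, radQ₄, radQ₆, UXc]
  ring

/-- `U_Y` of THE flux is the written-out closed form `UYc coeff`. [cite: Freidberg2014, §6.6.1 eq. (6.153)] -/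
theorem dZ_U_eq (X Y : ℝ) : dZ U X Y = UYc coeff X Y := by
  unfold U
  rw [dZ_cfSolution_zero coeff X Y]
  simp only [vertG₂, vertG₄, vertG₆, UYc]
  ring

/-- The GRADIENT-SQUARED field `(θ, s) ↦ |∇U|² = U_X² + U_Y²` at the ray point `(X_a + s cos θ, s sin θ)`, in closed form. -/
def Gfield (θ s : ℝ) : ℝ :=
  UXc coeff (Xa + s * Real.cos θ) (s * Real.sin θ) ^ 2 + UYc coeff (Xa + s * Real.cos θ) (s * Real.sin θ) ^ 2

/-- On every box of the loop the Fréchet derivative's components square-sum to `Gfield`: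
`(L(1,0))² + (L(0,1))² = U_X² + U_Y² = Gfield θ s`. -/
theorem box_factsG : ∀ k < 64, ∀ θ ∈ Icc (t64 k) (t64 (k + 1)), ∀ s ∈ Icc (σ₁ k) (σ₂ k),
    (Lray θ s (1, 0)) ^ 2 + (Lray θ s (0, 1)) ^ 2 = Gfield θ s := by
  intro k hk θ hθ s hs
  have hX := box_facts.2 k hk θ hθ s hs
  have hψ := box_facts.1 k hk θ hθ s hs
  obtain ⟨h1, h2⟩ := dR_dZ_of_hasFDerivAt (ψ := U) (R := Xa + s * Real.cos θ) (Z := 0 + s * Real.sin θ) hψ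
  rw [← h1, ← h2, dR_U_eq hX.ne', dZ_U_eq, zero_add]
  rfl

/-- On every box `Δ*U = 1·X²` (the `α = 0` Grad–Shafranov equation of the instance, `X > 0` there). -/
theorem box_factsGS : ∀ k < 64, ∀ θ ∈ Icc (t64 k) (t64 (k + 1)), ∀ s ∈ Icc (σ₁ k) (σ₂ k),
    gsOperator U (Xa + s * Real.cos θ) (0 + s * Real.sin θ) = 1 * (Xa + s * Real.cos θ) ^ 2 := by
  intro k hk θ hθ s hs
  rw [one_mul]
  exact gsOperator_of_isInstance isInstance_U _ (box_facts.2 k hk θ hθ s hs)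

/-! ## §2 The record of the surface and its fields by name -/

/-- THE GGJ / MERCIER (8.134) INPUTS OF THE LEVEL SURFACE `U = u` of THE CF ITER-like flux about its axis `(X_a, 0)`, free constant
`F`, Solov'ev class `C = 1` (`Δ*U = X²`): `PolarRay.ggjData F 1 U X_a 0 u` (label = level, Jardin's orientation).  MODELLED: analytic
CF equilibrium, ideal MHD. [cite: Jardin2010, §8.5.4 eq. (8.134)] -/
def ggjData (F u : ℝ) : SurfaceData := PolarRay.ggjData F 1 U Xa 0 u

section fields

variable {u : ℝ} (hu : u ∈ Ioo (u₀ - ((δQ : ℚ) : ℝ)) (u₀ + ((δQ : ℚ) : ℝ))) (F : ℝ)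
include hu

/-- `V′(u) = 2π∫₀^{2π} volKernel X_a Dfield θ (ρ_u θ) dθ > 0`. [cite: Jardin2010, §5.3 eq. (5.29)] -/
theorem ggjData_V'_eq : (ggjData F u).V' = 2 * Real.pi * ∫ θ in (0 : ℝ)..(2 * Real.pi), volKernel Xa Dfield θ (rayRadius U Xa 0 u θ)
    ∧ 0 < (ggjData F u).V' :=
  ⟨levelLoop.ggjData_V' F 1 box_facts.1 box_facts.2 hu, levelLoop.ggjData_V'_pos F 1 box_facts.1 box_facts.2 hu⟩

/-- `V″(u) = 2π∫₀^{2π} volKernelDs X_a Dfield F2field θ (ρ_u θ)/Dfield θ (ρ_u θ) dθ`. [cite: Jardin2010, §8.5.4 eq. (8.134)] -/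
theorem ggjData_V''_eq : (ggjData F u).V''
    = 2 * Real.pi * ∫ θ in (0 : ℝ)..(2 * Real.pi),
        volKernelDs Xa Dfield F2field θ (rayRadius U Xa 0 u θ) / Dfield θ (rayRadius U Xa 0 u θ) :=
  levelLoop.ggjData_V'' F 1 box_facts.1 box_facts.2 box_facts₂.1 box_facts₂.2 hu

/-- `Φ′(u) = F∫₀^{2π} polarKernel X_a Dfield θ (ρ_u θ) dθ` (`= 2πq(u)`). [cite: Jardin2010, §5.3 eq. (5.31)] -/
theorem ggjData_Φ'_eq : (ggjData F u).Φ' = F * ∫ θ in (0 : ℝ)..(2 * Real.pi), polarKernel Xa Dfield θ (rayRadius U Xa 0 u θ) :=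
  levelLoop.ggjData_Φ' F 1 box_facts.1 box_facts.2 hu

/-- `Φ″(u) = F∫₀^{2π} polarKernelDs X_a Dfield F2field θ (ρ_u θ)/Dfield θ (ρ_u θ) dθ` (`= 2π dq/du`). [cite: Jardin2010, §8.5.4 eq. (8.134)] -/
theorem ggjData_Φ''_eq : (ggjData F u).Φ''
    = F * ∫ θ in (0 : ℝ)..(2 * Real.pi),
        polarKernelDs Xa Dfield F2field θ (rayRadius U Xa 0 u θ) / Dfield θ (rayRadius U Xa 0 u θ) :=
  levelLoop.ggjData_Φ'' F 1 box_facts.1 box_facts.2 box_facts₂.1 box_facts₂.2 hu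

/-- `⟨σB²/|∇U|²⟩(u) = F·∫₀^{2π} invGradKernel ÷ ∫₀^{2π} volKernel` (`σB² ≡ F`). [cite: Jardin2010, §8.5.4 eq. (8.134)] -/
theorem ggjData_gσB2_eq : (ggjData F u).gσB2
    = F * ((∫ θ in (0 : ℝ)..(2 * Real.pi), invGradKernel Xa Dfield Gfield θ (rayRadius U Xa 0 u θ))
        / ∫ θ in (0 : ℝ)..(2 * Real.pi), volKernel Xa Dfield θ (rayRadius U Xa 0 u θ)) := by
  have h := levelLoop.ggjData_gσB2 F box_facts.1 box_facts.2 box_factsG box_factsGS hu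
  rw [one_mul] at h
  exact h

/-- `⟨σ²B²/|∇U|²⟩(u) = F²·∫₀^{2π} sigmaSqKernel ÷ ∫₀^{2π} volKernel`. [cite: Jardin2010, §8.5.4 eq. (8.134)] -/
theorem ggjData_gσ2B2_eq : (ggjData F u).gσ2B2
    = F ^ 2 * ((∫ θ in (0 : ℝ)..(2 * Real.pi), sigmaSqKernel F Xa Dfield Gfield θ (rayRadius U Xa 0 u θ))
        / ∫ θ in (0 : ℝ)..(2 * Real.pi), volKernel Xa Dfield θ (rayRadius U Xa 0 u θ)) := by
  have h := levelLoop.ggjData_gσ2B2 F box_facts.1 box_facts.2 box_factsG box_factsGS hu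
  rw [one_mul] at h
  exact h

/-- `⟨B²/|∇U|²⟩(u) = ∫₀^{2π} bsqGradKernel ÷ ∫₀^{2π} volKernel`. [cite: Jardin2010, §8.5.4 eq. (8.134)] -/
theorem ggjData_gB2_eq : (ggjData F u).gB2
    = (∫ θ in (0 : ℝ)..(2 * Real.pi), bsqGradKernel F Xa Dfield Gfield θ (rayRadius U Xa 0 u θ))
        / ∫ θ in (0 : ℝ)..(2 * Real.pi), volKernel Xa Dfield θ (rayRadius U Xa 0 u θ) :=
  levelLoop.ggjData_gB2 F 1 box_facts.1 box_facts.2 box_factsG hu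

/-- `⟨1/B²⟩(u) = ∫₀^{2π} invBsqKernel ÷ ∫₀^{2π} volKernel`. [cite: Jardin2010, §8.5.4 eq. (8.134)] -/
theorem ggjData_invB2_eq : (ggjData F u).invB2
    = (∫ θ in (0 : ℝ)..(2 * Real.pi), invBsqKernel F Xa Dfield Gfield θ (rayRadius U Xa 0 u θ))
        / ∫ θ in (0 : ℝ)..(2 * Real.pi), volKernel Xa Dfield θ (rayRadius U Xa 0 u θ) :=
  levelLoop.ggjData_invB2 F 1 box_facts.1 box_facts.2 box_factsG hu

omit hu in
/-- The constant fields: `Ψ′ = 2π`, `Ψ″ = 0`, `K′ = 0`, `p′ = −1`. [cite: Jardin2010, §5.3 eqs. (5.32)–(5.33)] -/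
theorem ggjData_consts : (ggjData F u).Ψ' = 2 * Real.pi ∧ (ggjData F u).Ψ'' = 0 ∧ (ggjData F u).K' = 0 ∧ (ggjData F u).p' = -1 :=
  ⟨rfl, rfl, rfl, rfl⟩

/-- **JARDIN'S MERCIER CRITERION (8.134) ON THE SURFACE `U = u` ⟺ ONE POLYNOMIAL INEQUALITY IN SIX θ-INTEGRALS of closed-form
kernels along `ρ_u`** (`Pd = ∫polarKernelDs/D`, `Wd = ∫volKernelDs/D`, `Aσ = ∫invGradKernel`, `As = ∫sigmaSqKernel`, `AB = ∫bsqGradKernel`,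
`Ai = ∫invBsqKernel`; fields `Dfield`, `F2field`, `Gfield`).  No value claimed. [cite: Jardin2010, §8.5.4 eq. (8.134)] -/
theorem mercierCriterion_iff : (ggjData F u).MercierCriterion ↔
    0 < mercierRegisterForm F 1
      (∫ θ in (0 : ℝ)..(2 * Real.pi), polarKernelDs Xa Dfield F2field θ (rayRadius U Xa 0 u θ) / Dfield θ (rayRadius U Xa 0 u θ))
      (∫ θ in (0 : ℝ)..(2 * Real.pi), volKernelDs Xa Dfield F2field θ (rayRadius U Xa 0 u θ) / Dfield θ (rayRadius U Xa 0 u θ))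
      (∫ θ in (0 : ℝ)..(2 * Real.pi), invGradKernel Xa Dfield Gfield θ (rayRadius U Xa 0 u θ))
      (∫ θ in (0 : ℝ)..(2 * Real.pi), sigmaSqKernel F Xa Dfield Gfield θ (rayRadius U Xa 0 u θ))
      (∫ θ in (0 : ℝ)..(2 * Real.pi), bsqGradKernel F Xa Dfield Gfield θ (rayRadius U Xa 0 u θ))
      (∫ θ in (0 : ℝ)..(2 * Real.pi), invBsqKernel F Xa Dfield Gfield θ (rayRadius U Xa 0 u θ)) :=
  levelLoop.mercierCriterion_ggjData_iff F box_facts.1 box_facts.2 box_facts₂.1 box_facts₂.2 box_factsG box_factsGS hu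

end fields

/-! ## §3 At `ψ_N = 1/2` itself (`u = u₀`, `ρ = ρ_{u₀}` = ★ #117's glued radius) -/

/-- `Φ′(u₀) = 2π·F·qHalfOverF` — Jardin's (5.31) on the surface `ψ_N = 1/2` is `2π` times Freidberg's `q` (6.35) there, which ★ #117
brackets: `2.40763819 ≤ qHalfOverF ≤ 2.40763845` (`qHalfOverF_bounds`). [cite: Jardin2010, §5.3 eq. (5.31)] -/
theorem ggjData_Φ'_half (F : ℝ) : (ggjData F u₀).Φ' = 2 * Real.pi * (F * qHalfOverF) := by
  rw [← safetyFactorE_loop_eq F]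
  exact toroidalFluxDerivJ_eq (ggjData_V'_eq u₀_mem F).2.ne' F

/-- **THE MERCIER CRITERION (8.134) AT `ψ_N = 1/2` OF THE CF ITER-like MODEL ⟺ `0 < mercierRegisterForm F 1 Pd Wd Aσ As AB Ai`**
with the six registers the θ-integrals over `[0, 2π]` of `polarKernelDs/Dfield`, `volKernelDs/Dfield`, `invGradKernel`, `sigmaSqKernel`,
`bsqGradKernel`, `invBsqKernel` (fields `Dfield`, `F2field`, `Gfield`) along ★ #117's certified radius `ρ`.  This is the whole analytic
content of a CF-rung Mercier row: what remains is six program registers + tube constants and one rational inequality.  NECESSARY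
criterion of the MODEL; no value, no sign claimed here. [cite: Jardin2010, §8.5.4 eq. (8.134)] -/
theorem mercierCriterion_half_iff (F : ℝ) : (ggjData F u₀).MercierCriterion ↔
    0 < mercierRegisterForm F 1
      (∫ θ in (0 : ℝ)..(2 * Real.pi), polarKernelDs Xa Dfield F2field θ (ρ θ) / Dfield θ (ρ θ))
      (∫ θ in (0 : ℝ)..(2 * Real.pi), volKernelDs Xa Dfield F2field θ (ρ θ) / Dfield θ (ρ θ))
      (∫ θ in (0 : ℝ)..(2 * Real.pi), invGradKernel Xa Dfield Gfield θ (ρ θ))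
      (∫ θ in (0 : ℝ)..(2 * Real.pi), sigmaSqKernel F Xa Dfield Gfield θ (ρ θ))
      (∫ θ in (0 : ℝ)..(2 * Real.pi), bsqGradKernel F Xa Dfield Gfield θ (ρ θ))
      (∫ θ in (0 : ℝ)..(2 * Real.pi), invBsqKernel F Xa Dfield Gfield θ (ρ θ)) :=
  mercierCriterion_iff u₀_mem F

end Summit.Ventures.FusionMHD.Models.CFIterLike.QHalf

end
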